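import Mathlib
import Literature.MathematicalPhysics.QuantumFieldTheory.Balaban1983to89.B2Sect2Statements

/-!
# `Balaban1983to89.B2Sect3AStatements` — [Balaban1982Higgs2] §3.A pp. 583–585: the displayed CLAIMS of the
# preliminary transformation — (3.1), the chapter-3 inductive hypothesis (3.5), the kernel bound (3.8) and the
# bound (3.10) — typed as `def … : Prop` over carriers whose fields NAME the printed quantities (proofs deferred;
# the same schematic style as this unit's `B2Sect2Statements` for (2.43)/(2.109))

statement-level skeleton of published theorems with citation tags; proofs where landed; nothing here is a claim about the Yang–Mills mass gap

CITATION HEADER.  T. Bałaban, *(Higgs)₂,₃ quantum fields in a finite volume. II. An upper bound*, Commun. Math. Phys.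
**86** (1982) 555–594 [Balaban1982Higgs2] (PDF held `paper:balaban1982-cmp86-higgs23-ii`, journal page = PDF page + 554;
pp. 583–585 [PDF 29–31] READ AS IMAGES on the ×2 renders
`run/shared/lean/pub/pub-balaban/b2b-balaban-ref1/pages/1982-cmp86-higgs23-II/1982-cmp86-higgs23-II-p029/p030/p031-x2.png`).
Cell `lit-balaban` (HOME `run/shared/lean/pub/lit-balaban/`), reader/typer seat **r02** gen 9 (unit `lit-balaban-r02-g9`,
owner of ROWS-B2); SKELETON row **B2.Eq3.1-3.10** (born ROWS-B2 v2.54; second reader r14 g11 SECONDREAD-B2 v25.1 PASS on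
the informal cell).  Companions: the DEFINITIONS (3.2)–(3.4) are typed with bodies in p23's `B2Eq32FieldRegularity`
(`field32`/`field34`); the IDENTITY (3.6) is proved in this seat's `B2Eq36ScaleDecomposition`; (3.9) is typed and
computed schematically in p04's `B2Sect3AGaussianStep` (`integral39_field`); (3.3) = (2.44) one scale is r14's
`B2StepK.bg244`; (3.8) = (2.109) is `B2Sect2Statements.Ineq2109` / r14's `B2StepK.KernelBound2109`.

WHAT IS PRINTED (verbatim where quoted; displays transcribed from the renders).
* p. 583 [PDF 29]: *"Rescaling the density ρ^{(K),L^Kε} to the unit lattice, using the restrictions on the fields B, ψ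
  arising from the characteristic functions χ_K, and making the transformations inverse to (2.47), we get the inequality*
  `ρ^{(K)}(Λ₀^{(0)}, …, Λ₀^{(K−1)}, B, θ_KB^{(K)}, ψ) ≦ ρ″^{(K)}(Λ₀^{(0)}, …, Λ₀^{(K−1)}, B, θ_KB^{(K)}, ψ)·exp(O((L^Kε)^κ)|Λ₅^{(K−1)′}|).  (3.1)`
  *The density ρ″^{(K)} is represented by the formula (2.45).  Let us formulate the inequalities we get in such a way after
  K − k steps as an inductive hypothesis. … Now we can formulate the inductive hypothesis:*
  `ρ^{(K),L^Kε}(Λ₀^{(0)}, …, Λ₀^{(K−1)}, A_K, Ã^{(K),ε}, φ_K) ≦ T^{L^{K−1}ε}_{a,L}T^{L^{K−1}ε}_{a,L,Ã^{(K−1),ε}}[χ_Kζ_{Λ₀^{(K−1)}}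
   χ_{Λ₋₁^{(K−1)}∩Λ₅^{(K−1)c}}·χ_{K−1,Λ₅^{(K−1)c}}T^{L^{K−2}ε}_{a,L}T^{L^{K−2}ε}_{a,L,Ã^{(K−2),ε}}[ζ_{Λ₀^{(K−2)}}·χ_{Λ₋₁^{(K−2)}∩Λ₅^{(K−2)c}}χ_{K−2,Λ₅^{(K−2)c}} ⋯
   T^{L^kε}_{a,L}T^{L^kε}_{a,L,Ã^{(k),ε}}[ζ_{Λ₀^{(k)}}χ_{Λ₋₁^{(k)}∩Λ₅^{(k)c}}χ_{k,Λ₅^{(k)c}} ρ′^{(k),L^kε}(Λ₀^{(0)}, …, Λ₀^{(k−1)}, A_k, Ã^{(k),ε}, φ_k)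
   ·exp[−½⟨Λ₆^{(k−1)′}A_k, Δ^{(k),L^kε}Λ₆^{(k−1)′}A_k⟩ − ½⟨(Λ₆^{(k−1)′}∩Λ₃^{(k)c})φ_k, Δ^{(k),L^kε}(B^k(Λ₂^{(k−1)′}∩Λ₅^{(k)c}), Ã^{(k),ε})(Λ₆^{(k−1)′}∩Λ₃^{(k)c})φ_k⟩
   − ⟨(Λ₆^{(k−1)′}∩Λ₃^{(k)c})φ_k, Δ^{(k),L^kε}(B^k(Λ₂^{(k−1)′}∩Λ₅^{(k)c}), Ã^{(k),ε})(Λ₃^{(k)}∩Λ₄^{(k)c})φ_k⟩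
   − ½⟨Λ₃^{(k)}φ_k, Δ^{(k),L^kε}(B^k(Λ₂^{(k)}), Ã^{(k+1),ε})Λ₃^{(k)}φ_k⟩]] … ]]·exp(Σ_{l=k+1}^{K} O(1)(L^lε)^κ|T_ε|).  (3.5)`
* p. 584 [PDF 30]: *"Also we have applied formula (2.108) together with the remark following it to the expression in the
  exponent in (3.5). According to the remark, the matrix elements h_k(x, x′) of the operator H_k satisfy the estimates*
  `|h_k(x, x′)| ≦ O(1)exp(−δ₁r(L^kε))exp(−δ₀|x − x′|),  x, x′ ∈ Λ₆^{(k−1)′}.  (3.8)`"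
* p. 585 [PDF 31]: *"The functions F′_k, F″_k are defined by these terms with opposite signs and by the terms coming from
  quadratic forms H′_k, H″_k, with only one variable localized to Λ₅^{(k)}. They have the property*
  `|F′_k(x)|,  |F″_k(x)| ≦ O(1)exp(−δ₁r(L^kε)).  (3.10)`
  *We will estimate this integral by the same integral without the last four terms in the exponent, i.e. the terms with
  H′_k, H″_k, F′_k, F″_k."*
Misprints on p. 584 located by the second reader (r14 g11, HOME/GAPS.md G-B2-11; kind = print, harmless): l. 14 *"from the
right side of (3.36)"* = (3.5); the (3.7) prefactor `χ_{k,Λ^{(k)c}}` = `χ_{k,Λ₅^{(k)c}}`.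

DICTIONARY / HONEST SCOPE.  (3.1), (3.5) are STEP inequalities between densities defined by the formulas (2.45)–(2.47) of
row B2.Eq2.44 (typed there only as named objects); here they are typed over carriers whose fields NAME those densities
at a configuration (`Run31.rhoK`/`rho2K`, `Run35.lhs`/`nested`), the printed "O(·)" being "some coefficient bounded by
one constant C uniform over the family of runs (all ε, T_ε) and steps" — exactly as (2.43) was typed in
`B2Sect2Statements.Ineq243Printed` (F6 of the cell's typing rules: everything printed inside the nested composition
lives inside the field `nested`).  (3.8) IS (2.109) (first inequality) read at the chapter-3 step — `Ineq38` is an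
`abbrev` of `Ineq2109`; (3.10) is typed with the decay rate `δ₁` SHARED with (3.8) (`Ineq310With δ₁`) and in the
self-contained ∃-form (`Ineq310`).  Nothing here is proved about Bałaban's densities; the analytic MECHANISM behind
(3.1)/(3.8)/(3.10) — a quadratic form with an (L^kε)^κ-small kernel over a region costs `exp(O((L^kε)^κ)|region|)`
— is in tree as kernel theorems (`B2StepK.rDecayBeatsPowers`/`kernelBound2109_pow_of_printed`,
`B2Sect3AGaussianStep.abs_quadForm_le_of_kernelBound`, `B2Ineq312OperatorNorm.norm312_le`).  value = the row's remaining
claim-displays typed in the cell's schematic currency — NOT summit progress.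
-/

namespace Literature.MathematicalPhysics.QuantumFieldTheory.Balaban1983to89.B2Sect3AStatements

open Literature.MathematicalPhysics.QuantumFieldTheory.Balaban1983to89.B2Sect2Statements (Ineq2109)

/-! ## (3.1) p. 583: the inverse-operations inequality at the top scale -/

/-- Carrier for ONE run of (3.1) (a torus `T_ε`, `K` steps): `Cfg` ↤ the arguments `(Λ₀^{(0)}, …, Λ₀^{(K−1)}, B,
θ_KB^{(K)}, ψ)` within the `χ_K` restrictions; `rhoK c` ↤ `ρ^{(K)}(c)` (the density (2.47) rescaled to the unit lattice);
`rho2K c` ↤ `ρ″^{(K)}(c)` *"represented by the formula (2.45)"*; `scaleK` ↤ `L^Kε`; `vol5 c` ↤ `|Λ₅^{(K−1)′}|` (a function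
of the regions in `c`). [cite: Balaban1982Higgs2, (3.1) p.583] -/
structure Run31 where
  Cfg : Type
  rhoK : Cfg → ℝ
  rho2K : Cfg → ℝ
  scaleK : ℝ
  vol5 : Cfg → ℕ

/-- **(3.1)** p. 583 [PDF 29]: `ρ^{(K)}(…) ≦ ρ″^{(K)}(…)·exp(O((L^Kε)^κ)|Λ₅^{(K−1)′}|)`, the constant in `O(·)` uniform
over the family of runs and configurations (`κ` the exponent fixed by the construction, as in (2.43)).
[cite: Balaban1982Higgs2, (3.1) p.583] -/
def Ineq31Printed (κ : ℝ) {I : Type} (fam : I → Run31) : Prop :=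
  ∃ C : ℝ, ∀ (i : I) (c : (fam i).Cfg),
    (fam i).rhoK c ≤ (fam i).rho2K c * Real.exp (C * (fam i).scaleK ^ κ * ((fam i).vol5 c : ℝ))

/-- Shape check: if `ρ^{(K)} ≤ ρ″^{(K)}` pointwise on every run, (3.1) holds with the constant `0`.
[cite: Balaban1982Higgs2, (3.1) p.583] -/
theorem ineq31Printed_of_le (κ : ℝ) {I : Type} (fam : I → Run31)
    (h : ∀ (i : I) (c : (fam i).Cfg), (fam i).rhoK c ≤ (fam i).rho2K c) : Ineq31Printed κ fam :=
  ⟨0, fun i c => by simpa using h i c⟩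

/-! ## (3.5) p. 583: the inductive hypothesis of chapter 3 (after `K − k` steps) -/

/-- Carrier for ONE run of the chapter-3 induction: `K` ↤ the number of steps; `Cfg` ↤ the arguments
`(Λ₀^{(0)}, …, Λ₀^{(K−1)}, A_K, Ã^{(K),ε}, φ_K)`; `lhs c` ↤ `ρ^{(K),L^Kε}(c)`; `nested k c` ↤ the right side of (3.5) after
`K − k` steps WITHOUT its last exponential factor, i.e. the nested composition
`T^{L^{K−1}ε}_{a,L}T^{L^{K−1}ε}_{a,L,Ã^{(K−1),ε}}[χ_Kζ_{Λ₀^{(K−1)}}χ_{Λ₋₁^{(K−1)}∩Λ₅^{(K−1)c}}·χ_{K−1,Λ₅^{(K−1)c}} ⋯ T^{L^kε}_{a,L}T^{L^kε}_{a,L,Ã^{(k),ε}}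
[ζ_{Λ₀^{(k)}}χ_{Λ₋₁^{(k)}∩Λ₅^{(k)c}}χ_{k,Λ₅^{(k)c}} ρ′^{(k),L^kε}(…)·exp[−½⟨Λ₆^{(k−1)′}A_k, Δ^{(k),L^kε}Λ₆^{(k−1)′}A_k⟩ − … −
½⟨Λ₃^{(k)}φ_k, Δ^{(k),L^kε}(B^k(Λ₂^{(k)}), Ã^{(k+1),ε})Λ₃^{(k)}φ_k⟩]]…]]` evaluated at `c` (every object printed inside it —
the renormalization transformations (I.2.12), the characteristic functions, `ρ′^{(k)}` (2.47), the forms `Δ^{(k)}`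
(2.46) — lives inside this field, typing rule F6); `scale l` ↤ `Lˡε`; `volT` ↤ `|T_ε|` (the printed volume, part I (1.21)).
[cite: Balaban1982Higgs2, (3.5) p.583] -/
structure Run35 where
  K : ℕ
  Cfg : Type
  lhs : Cfg → ℝ
  nested : ℕ → Cfg → ℝ
  scale : ℕ → ℝ
  volT : ℝ

/-- **(3.5)** p. 583 [PDF 29], the inductive hypothesis after `K − k` steps, `0 ≤ k ≤ K`:
`ρ^{(K),L^Kε}(…) ≦ [nested composition]_k · exp(Σ_{l=k+1}^{K} O(1)(Lˡε)^κ|T_ε|)`, the `O(1)` uniform over runs, steps and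
configurations (at `k = K` the sum is empty and `nested K` is `ρ^{(K)}`'s own representation, cf. (3.1)).
[cite: Balaban1982Higgs2, (3.5) p.583] -/
def IndHyp35 (κ : ℝ) {I : Type} (fam : I → Run35) : Prop :=
  ∃ C : ℝ, ∀ (i : I) (k : ℕ), k ≤ (fam i).K → ∀ c : (fam i).Cfg,
    (fam i).lhs c ≤ (fam i).nested k c *
      Real.exp (∑ l ∈ Finset.Ioc k (fam i).K, C * (fam i).scale l ^ κ * (fam i).volT)

/-- At the top `k = K` the exponential factor of (3.5) is `exp 0 = 1`: the hypothesis there reads `ρ^{(K),L^Kε} ≤ nested K`.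
[cite: Balaban1982Higgs2, (3.5) p.583] -/
theorem indHyp35_top {κ : ℝ} {I : Type} {fam : I → Run35} (h : IndHyp35 κ fam) (i : I) (c : (fam i).Cfg) :
    (fam i).lhs c ≤ (fam i).nested (fam i).K c := by
  obtain ⟨C, hC⟩ := h
  simpa using hC i (fam i).K le_rfl c

/-! ## (3.8) p. 584: the kernel of `H_k` — the first inequality of (2.109) at the chapter-3 step -/

/-- **(3.8)** p. 584 [PDF 30]: `|h_k(x, x′)| ≦ O(1)exp(−δ₁r(L^kε))exp(−δ₀|x − x′|)`, `x, x′ ∈ Λ₆^{(k−1)′}` — literally the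
first inequality of (2.109) p. 580 (*"we have applied formula (2.108) together with the remark following it"*), so the
typed statement IS `B2Sect2Statements.Ineq2109` over a family of steps exposing the kernel, the distance on
`Λ₆^{(k−1)′}` and `r = r(L^kε)`. [cite: Balaban1982Higgs2, (3.8) p.584] -/
abbrev Ineq38 {I : Type} (X : I → Type) (h dist : ∀ i, X i → X i → ℝ) (r : I → ℝ) : Prop := Ineq2109 X h dist r

/-- (3.8) and (2.109) are the same typed statement. [cite: Balaban1982Higgs2, (3.8) p.584] -/
theorem ineq38_iff_ineq2109 {I : Type} (X : I → Type) (h dist : ∀ i, X i → X i → ℝ) (r : I → ℝ) :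
    Ineq38 X h dist r ↔ Ineq2109 X h dist r := Iff.rfl

/-! ## (3.10) p. 585: the bound on `F′_k`, `F″_k` -/

/-- **(3.10)** p. 585 [PDF 31] with the decay rate `δ₁` of (3.8)/(2.109) GIVEN: `|F′_k(x)|, |F″_k(x)| ≦ O(1)exp(−δ₁r(L^kε))`
for `x ∈ Λ₅^{(k)}`, over a family of steps exposing the two functions on `Λ₅^{(k)}` and `r = r(L^kε)`; `O(1)` uniform.
[cite: Balaban1982Higgs2, (3.10) p.585] -/
def Ineq310With (δ₁ : ℝ) {I : Type} (X : I → Type) (F' F'' : ∀ i, X i → ℝ) (r : I → ℝ) : Prop :=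
  ∃ C : ℝ, ∀ (i : I) (x : X i),
    |F' i x| ≤ C * Real.exp (-(δ₁ * r i)) ∧ |F'' i x| ≤ C * Real.exp (-(δ₁ * r i))

/-- **(3.10)** p. 585 [PDF 31], self-contained form (`∃ O(1), δ₁ > 0` before the instance).
[cite: Balaban1982Higgs2, (3.10) p.585] -/
def Ineq310 {I : Type} (X : I → Type) (F' F'' : ∀ i, X i → ℝ) (r : I → ℝ) : Prop :=
  ∃ δ₁ : ℝ, 0 < δ₁ ∧ Ineq310With δ₁ X F' F'' r

/-- The shared-rate form with a positive rate gives the self-contained form. [cite: Balaban1982Higgs2, (3.10) p.585] -/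
theorem ineq310_of_with {δ₁ : ℝ} (hδ : 0 < δ₁) {I : Type} {X : I → Type} {F' F'' : ∀ i, X i → ℝ} {r : I → ℝ}
    (h : Ineq310With δ₁ X F' F'' r) : Ineq310 X F' F'' r :=
  ⟨δ₁, hδ, h⟩

/-- **(3.8) and (3.10) with ONE pair of constants**, as the print uses them together on p. 585 (*"we have the strong
estimates (3.8), (3.10)"*): a common `O(1)` and the same `δ₁` for the kernel `h_k` and the functions `F′_k, F″_k` of a
family of steps. [cite: Balaban1982Higgs2, (3.8) p.584; (3.10) p.585] -/
def Ineq38And310 {I : Type} (X Y : I → Type) (h dist : ∀ i, X i → X i → ℝ) (F' F'' : ∀ i, Y i → ℝ)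
    (r : I → ℝ) : Prop :=
  ∃ C δ₀ δ₁ : ℝ, 0 < δ₀ ∧ 0 < δ₁ ∧
    (∀ i (x x' : X i), |h i x x'| ≤ C * Real.exp (-(δ₁ * r i)) * Real.exp (-(δ₀ * dist i x x'))) ∧
    (∀ i (y : Y i), |F' i y| ≤ C * Real.exp (-(δ₁ * r i)) ∧ |F'' i y| ≤ C * Real.exp (-(δ₁ * r i)))

/-- The joint form yields (3.8) and (3.10) separately. [cite: Balaban1982Higgs2, (3.8) p.584; (3.10) p.585] -/
theorem Ineq38And310.split {I : Type} {X Y : I → Type} {h dist : ∀ i, X i → X i → ℝ} {F' F'' : ∀ i, Y i → ℝ}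
    {r : I → ℝ} (H : Ineq38And310 X Y h dist F' F'' r) : Ineq38 X h dist r ∧ Ineq310 Y F' F'' r := by
  obtain ⟨C, δ₀, δ₁, hδ₀, hδ₁, hh, hF⟩ := H
  exact ⟨⟨C, δ₀, δ₁, hδ₀, hδ₁, hh⟩, ⟨δ₁, hδ₁, C, hF⟩⟩

end Literature.MathematicalPhysics.QuantumFieldTheory.Balaban1983to89.B2Sect3AStatements
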